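import Mathlib
import HarnessLib
import Literature.Analysis.FluidPDE.SuitableWeak
import Literature.Analysis.FluidPDE.SelfSimilar
import Literature.Analysis.FluidPDE.LocalTypeI
import Literature.Analysis.FluidPDE.LocalTypeICongr
import Literature.Analysis.FluidPDE.LocalTypeILscGradient
import Literature.Analysis.FluidPDE.LocalTypeISlabProfile
import Literature.Analysis.FluidPDE.SlabTypeICompactness
import Literature.Analysis.FluidPDE.TypeIRateOseenMildRepresentative
import Summits.NavierStokesRegularity.NavierStokesRegularity.Theorems.RellichScarApexLocalisationSpherePersistence
import Summits.NavierStokesRegularity.NavierStokesRegularity.Theorems.RellichScarApexLocalisationParabolicActivity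

/-!
# The dissipation quantum of the rate-Type-I class (line dissipation-quantum-tolerance,
# crux ApexLocalisation, stub `stub_bandQuantumPos`)

The class of the line: suitable weak solutions `(u, p)` of Navier–Stokes on the backward slab
`𝕊 = (-∞, 0) × ℝ³` with weak spatial gradient `G`, Albritton–Barker quantity `𝐈(u,p,G) ≤ I < ⊤`,
the Type-I rate `‖u(t,x)‖ ≤ C/√(−t)` (`HasTypeITimeDecay C u`), continuous on the open slab.

`stub_bandQuantumPos`: given the two NS-specific inputs of the line — (S1) a continuous field with
ZERO weak spatial gradient on the open unit band `Q((−1/4,0),1/2) = (−1/2,−1/4) × B_{1/2}(0)` has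
slices constant on `B_{1/2}(0)`, and (S2) a continuous Oseen-mild rate field with the Morrey bound
whose band slices are constant on `B_{1/2}(0)` vanishes on `(−1/2,−1/4) × ℝ³` — every class
`(C, I)`, `I < ⊤`, has a DISSIPATION QUANTUM `e = e(C, I) > 0`: every continuous class profile that
is backward-singular at the space–time origin has `∫∫_{Q((−1/4,0),1/2)} |G|² ≥ e`.

Proof (contradiction + compactness, following `stub_parabolicActivity`):

1. if no `e > 0` works, pick for `e_k = 1/(k+1)` an origin-singular continuous class profile
   `(u_k, p_k, G_k)` with `∫∫_{band} |G_k|² < e_k`;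
2. the ENGINE `slab_typeI_compactness` (Albritton–Barker 2019, Lemma 2.2 + Prop. 2.3 on the
   slab) extracts `σ` and a limit `(v₀, q, H)` with `𝐈 ≤ 4 I`, `u_{σ j} → v₀` in `L³(Q(0, R))`;
   persistence at the FIXED origin makes the origin backward-singular for `v₀`;
3. the rate passes a.e. (`ae_rate_of_tendsto_eLpNorm`), a representative carries it pointwise
   (`exists_repr_hasTypeITimeDecay`), and `exists_oseenMild_repr_of_typeIBound_lt_top` gives a
   CONTINUOUS OSEEN-MILD representative `v` (class data transferred by `classData_congr_ae`);
4. NEW STEP: `v` has ZERO weak spatial gradient on the open band: for a test function `φ` on the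
   band, `∫∫ ∂_aφ ⟨u_{σ j}, w⟩ → ∫∫ ∂_aφ ⟨v, w⟩` (`L³` convergence on `Q(0,1) ⊇ band`,
   `tendsto_integral_mul_inner_of_tendsto_eLpNorm`), while
   `∫∫ ∂_aφ ⟨u_{σ j}, w⟩ = −∫∫_{band} φ ⟨G_{σ j} a, w⟩ → 0` by Cauchy–Schwarz, since
   `∫∫_{band} |G_{σ j}|² < e_{σ j} → 0`;
5. (S1) the slices of `v` are constant on the ball, (S2) `v = 0` on the band (Morrey bound from
   `𝐈 ≤ 4 I`, `ae_lintegral_ball_sq_le_of_typeIBound`);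
6. forward uniqueness from the zero slice `s₀ = −3/8` (`zero_after_zero_slice_of_oseenMild`):
   `v = 0` on `(−3/8, 0) × ℝ³ ⊇ Q(0, 1/2)`, so `‖v‖_{L^∞(Q(0,1/2))} = 0 ≠ ∞` — the origin is not
   singular for `v`, a contradiction.

## References

* D. Albritton, T. Barker, *On local Type I singularities of the Navier–Stokes equations and
  Liouville theorems*, J. Math. Fluid Mech. 21 (2019) = arXiv:1811.00502, Lemma 2.2, Prop. 2.3,
  §3. [AlbrittonBarker2019]
* L. Caffarelli, R. Kohn, L. Nirenberg, *Partial regularity of suitable weak solutions of the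
  Navier–Stokes equations*, Comm. Pure Appl. Math. 35 (1982), (2.1). [CaffarelliKohnNirenberg1982]
* L. C. Evans, *Partial Differential Equations*, 2nd ed. (2010), §5.2.1 (weak derivatives pass to
  `L¹_loc` limits). [Evans2010]
-/

set_option linter.dupNamespace false

namespace Summit.NavierStokesRegularity.NavierStokesRegularity.Theorems.RellichScarApexLocalisation

open MeasureTheory Set Function Metric Filter Topology TopologicalSpace
open scoped ENNReal NNReal RealInnerProductSpace
open Literature.Analysis Literature.Analysis.FluidPDE

local notation "E³" => EuclideanSpace ℝ (Fin 3)

/-! ### Tool 1: pairings with `L²`-vanishing gradients vanish in the limit -/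

/-- **Pairings with `L²`-vanishing operator fields vanish in the limit** (Cauchy–Schwarz). If the
operator fields `G j` are a.e.-strongly measurable on a set `S ⊆ ℝ × ℝ³` of finite measure with
`∫_S |G j|² → 0` (Frobenius norm), and `φ` is a bounded weight, then for all directions `a, w`,
`∫_S φ ⟪G j a, w⟫ → 0`: indeed
`|∫_S φ ⟪G a, w⟫| ≤ sup|φ| ‖a‖ ‖w‖ vol(S)^{1/2} (∫_S |G|²)^{1/2}`. -/
theorem tendsto_setIntegral_mul_inner_apply_of_tendsto_lintegral_frobenius
    {S : Set (ℝ × E³)} (hS : volume S ≠ ⊤) {G : ℕ → ℝ → E³ → E³ →L[ℝ] E³}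
    (hGm : ∀ j, AEStronglyMeasurable (uncurry (G j)) (volume.restrict S))
    (hG0 : Tendsto (fun j => ∫⁻ z in S, ENNReal.ofReal (frobeniusNormSq (G j z.1 z.2)))
      atTop (𝓝 0))
    {φ : ℝ → E³ → ℝ} {Cφ : ℝ} (hφ : ∀ t x, ‖φ t x‖ ≤ Cφ) (a w : E³) :
    Tendsto (fun j => ∫ z in S, φ z.1 z.2 * ⟪G j z.1 z.2 a, w⟫) atTop (𝓝 0) := by
  set μ : Measure (ℝ × E³) := volume.restrict S with hμ
  set K : ℝ≥0∞ := ENNReal.ofReal Cφ * ‖a‖ₑ * ‖w‖ₑ with hK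
  have hKtop : K ≠ ⊤ :=
    ENNReal.mul_ne_top (ENNReal.mul_ne_top ENNReal.ofReal_ne_top enorm_ne_top) enorm_ne_top
  -- the bound `B j = K vol(S)^{1/2} (∫_S |G j|²)^{1/2} → 0`
  set B : ℕ → ℝ≥0∞ := fun j => K * (volume S ^ (1 / 2 : ℝ) *
    (∫⁻ z, ENNReal.ofReal (frobeniusNormSq (G j z.1 z.2)) ∂μ) ^ (1 / 2 : ℝ)) with hB
  have hBlim : Tendsto B atTop (𝓝 0) := by
    have h1 : Tendsto (fun j => (∫⁻ z, ENNReal.ofReal (frobeniusNormSq (G j z.1 z.2)) ∂μ) ^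
        (1 / 2 : ℝ)) atTop (𝓝 0) := by
      have h := ((ENNReal.continuous_rpow_const (y := (1 / 2 : ℝ))).tendsto 0).comp hG0
      rwa [ENNReal.zero_rpow_of_pos (by norm_num : (0 : ℝ) < 1 / 2)] at h
    have h2 : Tendsto (fun j => volume S ^ (1 / 2 : ℝ) *
        (∫⁻ z, ENNReal.ofReal (frobeniusNormSq (G j z.1 z.2)) ∂μ) ^ (1 / 2 : ℝ)) atTop (𝓝 0) := by
      have h := ENNReal.Tendsto.const_mul h1
        (Or.inr (ENNReal.rpow_ne_top_of_nonneg (by norm_num : (0 : ℝ) ≤ 1 / 2) hS))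
      rwa [mul_zero] at h
    have h3 := ENNReal.Tendsto.const_mul h2 (Or.inr hKtop)
    rwa [mul_zero] at h3
  -- the pointwise bound `‖φ ⟪G a, w⟫‖ ≤ K |G|`
  have hpt : ∀ j (z : ℝ × E³), ‖φ z.1 z.2 * ⟪G j z.1 z.2 a, w⟫‖ₑ ≤
      K * ENNReal.ofReal (frobeniusNormSq (G j z.1 z.2)) ^ (1 / 2 : ℝ) := by
    intro j z
    rw [enorm_mul]
    calc ‖φ z.1 z.2‖ₑ * ‖⟪G j z.1 z.2 a, w⟫‖ₑ
        ≤ ENNReal.ofReal Cφ * (‖G j z.1 z.2 a‖ₑ * ‖w‖ₑ) := by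
          gcongr
          · rw [← ofReal_norm]
            exact ENNReal.ofReal_le_ofReal (hφ z.1 z.2)
          · rw [← ofReal_norm, ← ofReal_norm, ← ofReal_norm, ← ENNReal.ofReal_mul (norm_nonneg _)]
            exact ENNReal.ofReal_le_ofReal (norm_inner_le_norm _ _)
      _ ≤ ENNReal.ofReal Cφ *
          (ENNReal.ofReal (frobeniusNormSq (G j z.1 z.2)) ^ (1 / 2 : ℝ) * ‖a‖ₑ * ‖w‖ₑ) := by
          gcongr
          exact enorm_apply_le_frobenius_mul _ _
      _ = K * ENNReal.ofReal (frobeniusNormSq (G j z.1 z.2)) ^ (1 / 2 : ℝ) := by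
          rw [hK]; ring
  -- Cauchy–Schwarz: `∫_S |G| ≤ vol(S)^{1/2} (∫_S |G|²)^{1/2}`
  have hCS : ∀ j, ∫⁻ z, ENNReal.ofReal (frobeniusNormSq (G j z.1 z.2)) ^ (1 / 2 : ℝ) ∂μ ≤
      volume S ^ (1 / 2 : ℝ) *
        (∫⁻ z, ENNReal.ofReal (frobeniusNormSq (G j z.1 z.2)) ∂μ) ^ (1 / 2 : ℝ) := by
    intro j
    have hgm : AEMeasurable
        (fun z : ℝ × E³ => ENNReal.ofReal (frobeniusNormSq (G j z.1 z.2)) ^ (1 / 2 : ℝ)) μ := by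
      have h1 : AEStronglyMeasurable (fun z : ℝ × E³ => frobeniusNormSq (uncurry (G j) z)) μ :=
        continuous_frobeniusNormSq'.comp_aestronglyMeasurable (hGm j)
      exact h1.aemeasurable.ennreal_ofReal.pow_const _
    have h := ENNReal.lintegral_mul_le_Lp_mul_Lq μ
      (Real.holderConjugate_iff.2 ⟨by norm_num, by norm_num⟩ : (2 : ℝ).HolderConjugate 2)
      (aemeasurable_const (b := (1 : ℝ≥0∞))) hgm
    have e2 : ∀ x : ℝ≥0∞, (x ^ (1 / 2 : ℝ)) ^ (2 : ℝ) = x := fun x => by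
      rw [← ENNReal.rpow_mul, show (1 / 2 : ℝ) * 2 = 1 by norm_num, ENNReal.rpow_one]
    simpa only [Pi.mul_apply, one_mul, ENNReal.one_rpow, lintegral_const, hμ,
      Measure.restrict_apply_univ, e2] using h
  -- the estimate `‖∫_S φ ⟪G j a, w⟫‖ ≤ B j`
  have hest : ∀ j, ‖∫ z, φ z.1 z.2 * ⟪G j z.1 z.2 a, w⟫ ∂μ‖ₑ ≤ B j := by
    intro j
    refine (enorm_integral_le_lintegral_enorm _).trans ?_
    refine (lintegral_mono (hpt j)).trans ?_
    rw [lintegral_const_mul' _ _ hKtop]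
    exact mul_le_mul_right (hCS j) K
  -- conclude
  rw [tendsto_iff_edist_tendsto_0]
  refine tendsto_of_tendsto_of_tendsto_of_le_of_le tendsto_const_nhds hBlim (fun j => bot_le)
    fun j => ?_
  rw [edist_eq_enorm_sub, sub_zero]
  exact hest j

/-! ### Tool 2: `L³_loc` limits of fields with `L²`-vanishing gradients have zero weak gradient -/

/-- **An `L³_loc` limit of fields whose gradients vanish in `L²` has zero weak spatial gradient**
(weak derivatives pass to `L¹_loc` limits, Evans *PDE* §5.2.1, in the space–time form of CKN 1982
(2.1)). Let `Ω ⊆ Q₀` be an open region of finite measure, `G_j` weak spatial gradients of `W_j` on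
`Ω` with `∫_Ω |G_j|² → 0`, `v` locally integrable on `Ω`, and `W_j → v` in `L³(Q₀)`. Then `0` is a
weak spatial gradient of `v` on `Ω`: for a test function `φ` on `Ω`,
`∫∫ ∂_aφ ⟪W_j, w⟫ → ∫∫ ∂_aφ ⟪v, w⟫` (`tendsto_integral_mul_inner_of_tendsto_eLpNorm`) while
`∫∫ ∂_aφ ⟪W_j, w⟫ = −∫_Ω φ ⟪G_j a, w⟫ → 0` (Cauchy–Schwarz). [cite: Evans2010, §5.2.1] -/
theorem hasWeakSpatialGradientOn_zero_of_tendsto_lintegral_frobenius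
    {Ω : Opens (ℝ × E³)} {Q₀ : Set (ℝ × E³)} (hΩQ : (Ω : Set (ℝ × E³)) ⊆ Q₀)
    (hΩfin : volume (Ω : Set (ℝ × E³)) ≠ ⊤)
    {W : ℕ → ℝ → E³ → E³} {G : ℕ → ℝ → E³ → E³ →L[ℝ] E³} {v : ℝ → E³ → E³}
    (hG : ∀ j, HasWeakSpatialGradientOn Ω (W j) (G j))
    (hv : LocallyIntegrableOn (uncurry v) (Ω : Set (ℝ × E³)) volume)
    (hconv : Tendsto (fun j => eLpNorm (uncurry (W j) - uncurry v) 3 (volume.restrict Q₀))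
      atTop (𝓝 0))
    (hG0 : Tendsto (fun j => ∫⁻ z in (Ω : Set (ℝ × E³)),
      ENNReal.ofReal (frobeniusNormSq (G j z.1 z.2))) atTop (𝓝 0)) :
    HasWeakSpatialGradientOn Ω v 0 := by
  have hz : LocallyIntegrableOn (uncurry (0 : ℝ → E³ → E³ →L[ℝ] E³)) (Ω : Set (ℝ × E³)) volume := by
    rw [show uncurry (0 : ℝ → E³ → E³ →L[ℝ] E³) = fun _ => 0 from rfl]
    exact locallyIntegrableOn_zero (ε'' := E³ →L[ℝ] E³)
  refine ⟨hv, hz, fun φ hφ a w => ?_⟩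
  suffices h0 : ∫ t, ∫ x, fderiv ℝ (φ t) x a * ⟪v t x, w⟫ = 0 by
    rw [h0]; simp
  -- the weight `θ = ∂_a φ`
  have hK : IsCompact (tsupport (uncurry φ)) := hφ.hasCompactSupport
  have hKΩ : tsupport (uncurry φ) ⊆ (Ω : Set (ℝ × E³)) := hφ.tsupport_subset
  have hdφ : IsSpaceTimeTestOn ⊤ (fun t x => fderiv ℝ (φ t) x a) :=
    (hφ.mono le_top).fderiv_apply_top a
  have hθc : Continuous (fun z : ℝ × E³ => fderiv ℝ (φ z.1) z.2 a) := hdφ.contDiff.continuous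
  have hθ0 : ∀ z ∉ tsupport (uncurry φ), fderiv ℝ (φ z.1) z.2 a = 0 := by
    rintro ⟨t, x⟩ hz
    simp [IsSpaceTimeTestOn.fderiv_slice_eq_zero_of_notMem hz]
  have hθcs : HasCompactSupport (fun z : ℝ × E³ => fderiv ℝ (φ z.1) z.2 a) :=
    HasCompactSupport.intro hK hθ0
  have hθΩ : tsupport (fun z : ℝ × E³ => fderiv ℝ (φ z.1) z.2 a) ⊆ (Ω : Set (ℝ × E³)) :=
    (tsupport_subset_of_isClosed (isClosed_tsupport _) hθ0).trans hKΩ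
  -- the pairings with the fields converge
  have hA : Tendsto (fun j => ∫ z : ℝ × E³, fderiv ℝ (φ z.1) z.2 a * ⟪W j z.1 z.2, w⟫) atTop
      (𝓝 (∫ z : ℝ × E³, fderiv ℝ (φ z.1) z.2 a * ⟪v z.1 z.2, w⟫)) :=
    tendsto_integral_mul_inner_of_tendsto_eLpNorm hΩQ (fun j => (hG j).locallyIntegrableOn) hv
      hconv hθc hθcs hθΩ w
  -- and equal minus the pairings with the gradients, which tend to zero
  have hj : ∀ j, ∫ z : ℝ × E³, fderiv ℝ (φ z.1) z.2 a * ⟪W j z.1 z.2, w⟫ =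
      -∫ z in (Ω : Set (ℝ × E³)), φ z.1 z.2 * ⟪G j z.1 z.2 a, w⟫ := fun j => by
    rw [setIntegral_mul_inner_weakGradient_eq (hG j) hφ a w, neg_neg]
  obtain ⟨Cφ, hCφ⟩ := hφ.contDiff.continuous.bounded_above_of_compact_support hφ.hasCompactSupport
  have hB := tendsto_setIntegral_mul_inner_apply_of_tendsto_lintegral_frobenius hΩfin
    (fun j => (hG j).locallyIntegrableOn_grad.aestronglyMeasurable) hG0
    (φ := φ) (fun t x => hCφ (t, x)) a w
  have hA0 : Tendsto (fun j => ∫ z : ℝ × E³, fderiv ℝ (φ z.1) z.2 a * ⟪W j z.1 z.2, w⟫) atTop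
      (𝓝 0) := by
    simp only [hj]
    simpa using hB.neg
  have hlim0 : ∫ z : ℝ × E³, fderiv ℝ (φ z.1) z.2 a * ⟪v z.1 z.2, w⟫ = 0 :=
    tendsto_nhds_unique hA hA0
  -- iterated integral = product integral
  have hint : Integrable (fun z : ℝ × E³ => fderiv ℝ (φ z.1) z.2 a * ⟪v z.1 z.2, w⟫) volume := by
    have h := integrable_inner_of_locallyIntegrableOn hv
      (w := fun z : ℝ × E³ => fderiv ℝ (φ z.1) z.2 a • w) (hθc.smul continuous_const) hK hKΩ
      (fun z hz => by rw [hθ0 z hz, zero_smul])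
    exact h.congr (ae_of_all _ fun z => by simp only [real_inner_smul_right])
  have hprod : Integrable (fun z : ℝ × E³ => fderiv ℝ (φ z.1) z.2 a * ⟪v z.1 z.2, w⟫)
      ((volume : Measure ℝ).prod (volume : Measure E³)) := by
    rw [← Measure.volume_eq_prod]
    exact hint
  rw [← hlim0, Measure.volume_eq_prod, integral_prod _ hprod]

/-! ### The stub -/

/-- **S3, THE DISSIPATION QUANTUM** (inputs: S1 `hS1`, S2 `hS2`): for every class `(C, I)`, `I < ⊤`,
there is `e > 0` such that every continuous class profile singular at the origin has unit-band
dissipation `∫∫_{Q((−1/4,0),1/2)} |G|² ≥ e`, where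
`Q((−1/4,0),1/2) = (−1/2,−1/4) × B_{1/2}(0)`. (Engine `slab_typeI_compactness` on a violating
sequence, persistence at the fixed origin, continuous Oseen-mild representative; the limit has
ZERO weak gradient on the band (fields converge in `L³`, gradients vanish in `L²`), so S1 + S2
make it vanish on the band and `zero_after_zero_slice_of_oseenMild` afterwards — not singular.)
[cite: AlbrittonBarker2019, Lemma 2.2, Prop. 2.3 and §3] -/
theorem stub_bandQuantumPos
    (hS1 : ∀ (u : ℝ → E³ → E³), ContinuousOn (uncurry u) (Iio (0 : ℝ) ×ˢ univ) →
      HasWeakSpatialGradientOn (parabolicCylinderOpens (1 / 2 : ℝ) ((-(1 / 4) : ℝ), (0 : E³))) u 0 →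
      ∀ t ∈ Ioo (-(1 / 2) : ℝ) (-(1 / 4)), ∀ x ∈ ball (0 : E³) (1 / 2), ∀ y ∈ ball (0 : E³) (1 / 2),
        u t x = u t y)
    (hS2 : ∀ (v : ℝ → E³ → E³) (C I : ℝ), ContinuousOn (uncurry v) (Iio (0 : ℝ) ×ˢ univ) →
      HasTypeITimeDecay C v →
      (∀ s t : ℝ, s < t → t < 0 → ∀ x : E³,
        v t x = UnboundedOperators.heatExtension (v s) (t - s) x - oseenDuhamel 1 s v v t x) →
      (∀ m : ℝ, 1 ≤ m → ∀ᵐ t ∂(volume.restrict (Ioo (-m ^ 2) (0 : ℝ))),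
        ∫⁻ y in ball (0 : E³) m, ‖v t y‖ₑ ^ 2 ≤ ENNReal.ofReal (I * m)) →
      (∀ t ∈ Ioo (-(1 / 2) : ℝ) (-(1 / 4)), ∀ x ∈ ball (0 : E³) (1 / 2), ∀ y ∈ ball (0 : E³) (1 / 2),
        v t x = v t y) →
      ∀ t ∈ Ioo (-(1 / 2) : ℝ) (-(1 / 4)), ∀ x : E³, v t x = 0) :
    ∀ (C : ℝ) (I : ℝ≥0∞), I < ⊤ → ∃ e : ℝ, 0 < e ∧
      ∀ (u : ℝ → E³ → E³) (p : ℝ → E³ → ℝ) (G : ℝ → E³ → E³ →L[ℝ] E³),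
        IsSuitableWeakSolutionOn (slab E³ (Iio 0) isOpen_Iio) 1 0 u p →
        HasWeakSpatialGradientOn (slab E³ (Iio 0) isOpen_Iio) u G →
        typeIBound (Iio (0 : ℝ) ×ˢ univ) u p G ≤ I →
        HasTypeITimeDecay C u →
        ContinuousOn (uncurry u) (Iio (0 : ℝ) ×ˢ univ) →
        IsBackwardSingularPoint u 0 →
        ENNReal.ofReal e ≤ ∫⁻ z in parabolicCylinder (1 / 2 : ℝ) ((-(1 / 4) : ℝ), (0 : E³)),
          ENNReal.ofReal (frobeniusNormSq (G z.1 z.2)) := by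
  intro C I hI
  by_contra h
  push Not at h
  -- ## Step 1: violators for `e_k = 1/(k+1)`
  have hη : ∀ k : ℕ, (0 : ℝ) < 1 / ((k : ℝ) + 1) := fun k => by positivity
  choose u p G hsw hwg hIle hC _hcont hsing hsmall using fun k : ℕ => h (1 / ((k : ℝ) + 1)) (hη k)
  -- `0 ≤ C` (the rate of `u 0` at `(t, x) = (-1, 0)`)
  have hC0 : 0 ≤ C := by
    have h := hC 0 (-1) (by norm_num) 0
    rw [neg_neg, Real.sqrt_one, div_one] at h
    exact (norm_nonneg _).trans h
  -- ## Step 2: the ENGINE on the sequence itself; persistence at the fixed origin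
  obtain ⟨v₀, q, H, σ, hσ, hsw₀, hwg₀, hI₀, hconv₀, hpers₀⟩ :=
    slab_typeI_compactness I u p G hI hsw hwg hIle
  have hsing₀ : IsBackwardSingularPoint v₀ 0 := by
    refine hpers₀ fun R hR => ?_
    have hconst : (fun j => eLpNorm (uncurry (u (σ j))) ⊤
        (volume.restrict (parabolicCylinder R (0 : ℝ × E³)))) = fun _ => (⊤ : ℝ≥0∞) :=
      funext fun j => hsing (σ j) R hR
    rw [hconst]
    exact limsup_const ⊤
  -- ## Step 3: the rate a.e., a representative with the pointwise rate, a continuous mild one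
  have hrate₀ : ∀ᵐ z ∂(volume.restrict (Iio (0 : ℝ) ×ˢ (univ : Set E³))),
      ‖v₀ z.1 z.2‖ ≤ C / Real.sqrt (-z.1) :=
    ae_rate_of_tendsto_eLpNorm (W := fun j => u (σ j))
      (fun j => (hwg (σ j)).locallyIntegrableOn.aestronglyMeasurable)
      hwg₀.locallyIntegrableOn.aestronglyMeasurable (fun j => hC (σ j))
      (fun n => hconv₀ ((n : ℝ) + 1) (by positivity))
  obtain ⟨v₁, hae₁, hC₁⟩ := exists_repr_hasTypeITimeDecay hC0 hrate₀
  obtain ⟨hsw₁, hwg₁, hI₁, hsing₁, hconv₁⟩ := classData_congr_ae hae₁ hsw₀ hwg₀ hI₀ hsing₀ hconv₀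
  have h4I : 4 * I < ⊤ := ENNReal.mul_lt_top (by simp) hI
  have hI₁top : typeIBound (Iio (0 : ℝ) ×ˢ univ) v₁ q H < ⊤ := lt_of_le_of_lt hI₁ h4I
  obtain ⟨v, hae₂, hvcont, -, hmild, hvC⟩ :=
    exists_oseenMild_repr_of_typeIBound_lt_top hsw₁ hC₁ hI₁top
  obtain ⟨-, hwgv, hIv, hsingv, hconvv⟩ := classData_congr_ae hae₂ hsw₁ hwg₁ hI₁ hsing₁ hconv₁
  -- ## Step 4: the limit has ZERO weak spatial gradient on the open unit band
  set Ω : Opens (ℝ × E³) := parabolicCylinderOpens (1 / 2 : ℝ) ((-(1 / 4) : ℝ), (0 : E³)) with hΩ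
  have hΩslab : Ω ≤ slab E³ (Iio 0) isOpen_Iio := parabolicCylinderOpens_le_slab _ (by norm_num)
  have hΩQ : (Ω : Set (ℝ × E³)) ⊆ parabolicCylinder 1 (0 : ℝ × E³) := by
    intro z hz
    rw [hΩ, coe_parabolicCylinderOpens, mem_parabolicCylinder] at hz
    obtain ⟨⟨hz1, hz2⟩, hz3⟩ := hz
    rw [mem_parabolicCylinder]
    simp only [Prod.fst_zero, Prod.snd_zero] at hz3 ⊢
    norm_num at hz1 hz2 hz3 ⊢
    exact ⟨⟨by linarith, by linarith⟩, by linarith⟩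
  have hG0 : Tendsto (fun j => ∫⁻ z in (Ω : Set (ℝ × E³)),
      ENNReal.ofReal (frobeniusNormSq (G (σ j) z.1 z.2))) atTop (𝓝 0) := by
    have hεσ : Tendsto (fun j => ENNReal.ofReal (1 / (((σ j : ℕ) : ℝ) + 1))) atTop (𝓝 0) := by
      have h := ENNReal.tendsto_ofReal
        (tendsto_one_div_add_atTop_nhds_zero_nat.comp hσ.tendsto_atTop)
      rwa [ENNReal.ofReal_zero] at h
    exact tendsto_of_tendsto_of_tendsto_of_le_of_le tendsto_const_nhds hεσ (fun j => bot_le)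
      fun j => (hsmall (σ j)).le
  have hgradv : HasWeakSpatialGradientOn Ω v 0 :=
    hasWeakSpatialGradientOn_zero_of_tendsto_lintegral_frobenius hΩQ
      (volume_parabolicCylinder_ne_top _ _) (fun j => (hwg (σ j)).mono hΩslab)
      (hwgv.locallyIntegrableOn.mono_set hΩslab) (hconvv 1 one_pos) hG0
  -- ## Step 5: constant slices (S1), zero on the band (S2, Morrey bound from `𝐈 ≤ 4 I`)
  have hconst := hS1 v hvcont hgradv
  have hIv' : typeIBound (Iio (0 : ℝ) ×ˢ univ) v q H ≤ ENNReal.ofReal ((4 * I).toReal) := by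
    rw [ENNReal.ofReal_toReal h4I.ne]
    exact hIv
  have hMorrey : ∀ m : ℝ, 1 ≤ m → ∀ᵐ t ∂(volume.restrict (Ioo (-m ^ 2) (0 : ℝ))),
      ∫⁻ y in ball (0 : E³) m, ‖v t y‖ₑ ^ 2 ≤ ENNReal.ofReal ((4 * I).toReal * m) :=
    fun m hm => ae_lintegral_ball_sq_le_of_typeIBound hIv' (lt_of_lt_of_le one_pos hm)
  have hband : ∀ t ∈ Ioo (-(1 / 2) : ℝ) (-(1 / 4)), ∀ x : E³, v t x = 0 :=
    hS2 v C ((4 * I).toReal) hvcont hvC hmild hMorrey hconst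
  -- ## Step 6: zero after the zero slice `s₀ = -3/8` (forward uniqueness)
  have hafter : ∀ t : ℝ, (-(3 / 8) : ℝ) < t → t < 0 → ∀ x : E³, v t x = 0 :=
    zero_after_zero_slice_of_oseenMild (by norm_num) hvcont hvC hmild
      (hband (-(3 / 8)) ⟨by norm_num, by norm_num⟩)
  -- ## Step 7: contradiction — `‖v‖_{L^∞(Q(0,1/2))} = 0 ≠ ∞`
  have hQm : MeasurableSet (parabolicCylinder (1 / 2 : ℝ) (0 : ℝ × E³)) :=
    (isOpen_parabolicCylinder _ _).measurableSet
  have hv0' : uncurry v =ᵐ[volume.restrict (parabolicCylinder (1 / 2 : ℝ) (0 : ℝ × E³))]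
      (0 : ℝ × E³ → E³) := by
    refine (ae_restrict_mem hQm).mono fun z hz => ?_
    simp only [mem_parabolicCylinder, Prod.fst_zero, Prod.snd_zero] at hz
    have hz1 : (-(3 / 8) : ℝ) < z.1 := by nlinarith [hz.1.1]
    exact hafter z.1 hz1 hz.1.2 z.2
  have hzero : eLpNorm (uncurry v) ⊤
      (volume.restrict (parabolicCylinder (1 / 2 : ℝ) (0 : ℝ × E³))) = 0 := by
    rw [eLpNorm_congr_ae hv0', eLpNorm_zero]
  have htop : eLpNorm (uncurry v) ⊤
      (volume.restrict (parabolicCylinder (1 / 2 : ℝ) (0 : ℝ × E³))) = ⊤ :=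
    hsingv (1 / 2) (by norm_num)
  rw [hzero] at htop
  exact ENNReal.zero_ne_top htop

end Summit.NavierStokesRegularity.NavierStokesRegularity.Theorems.RellichScarApexLocalisation
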